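import Literature.NumberTheory.Automorphic.GLTwoAdelicTorus
import Literature.NumberTheory.Automorphic.QuaternionTorusCentralizer
import HarnessLib

/-!
# The volume factor of an elliptic class of `GL(2)`: `vol(C(γ) ⧸ (ℝ_{>0} GL₂(K) ∩ C(γ))) =
vol(E_𝔸ˣ ⧸ ℝ_{>0} Eˣ)`, `E = K(γ)`
(Gelbart, *Automorphic forms on adele groups* (1975), (10.15) and p. 155: `meas(Z_𝔸 B_F \ B_𝔸)`,
`B = B(E)` the centraliser of the quadratic extension `E`; Jacquet–Langlands, LNM 114, §16)

Topic `NumberTheory/Automorphic`; theorems only (no definition, no named fact, no instance). The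
`GL(2)` twin of the `Volume` section of `QuaternionTorusCentralizer`: there the volume factor
`vol(G_γ' ⧸ H_γ')` of a regular class of the `D^×` trace formula (10.14) was identified with the
covolume of `ℝ_{>0} Tˣ` in the idele group `T_𝔸ˣ` of the quadratic field `T = K(γ')`; here, for a
non-scalar `γ ∈ GL₂(K)` with `E = C_{M₂(K)}(γ) = K[γ]`, `G_γ = C_{GL₂(𝔸_K)}(γ)` and
`H_γ = ℝ_{>0} GL₂(K) ∩ G_γ`, the torus isomorphism `e = glTwoDatumTorusEquiv : E_𝔸ˣ ≃ₜ* G_γ` of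
`GLTwoAdelicTorus` (carrying `ℝ_{>0} Eˣ` onto `H_γ`, `glTwoDatumTorusEquiv_mem_iff`) gives

* `glTwo_quotientMeasure_centralizer_univ_eq_torus` — **if the Haar-type measures correspond under
  `e` (`ν_γ = e_* ν_E` on `G_γ`, `ρ_F = (e|)_* ρ_E` on `H_γ`) then
  `vol(G_γ ⧸ H_γ; ν_γ, ρ_F) = vol(E_𝔸ˣ ⧸ ℝ_{>0} Eˣ; ν_E, ρ_E)`**, both volumes being total masses of
  quotient measures with Weil constant one (`quotientMeasure_univ_eq_of_mulEquiv`,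
  `InvariantQuotientTransport`);
* `glTwo_exists_torus_measures` — non-vacuity: the pull-backs of `ν_γ`, `ρ_F` along `e` are
  Haar-type measures on `E_𝔸ˣ`, `ℝ_{>0} Eˣ` which correspond to them.

So the volume factor of the elliptic term of `γ` in the `GL(2)` trace formula (10.15) is the same
torus-intrinsic quantity as the volume factor of the class of `γ'` in (10.14) whenever
`K(γ) ≅ K(γ')` with matching measures — the equality `meas(Z'_𝔸 B'_F \ B'_𝔸) = meas(Z_𝔸 B_F \ B_𝔸)`
used on p. 155 of Gelbart (1975). A brick of the inline (D-0026) decomposition of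
`Literature.NumberTheory.Automorphic.strong_multiplicity_one_quaternionUnits` (Gelbart Thm. 10.5).

## References

* S. Gelbart, *Automorphic forms on adele groups*, Ann. of Math. Studies 83 (1975), (10.14),
  (10.15), pp. 154–155 [Gelbart1975].
* H. Jacquet, R. P. Langlands, *Automorphic forms on GL(2)*, LNM 114 (1970), §16
  [JacquetLanglands1970].
-/

noncomputable section

open scoped TensorProduct NNReal ENNReal
open NumberField IsDedekindDomain MeasureTheory Measure Topology
open Literature.MeasureTheory.Group

namespace Literature.NumberTheory.Automorphic

-- the coset spaces carry Borel σ-algebras supplied locally, not the quotient σ-algebra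
attribute [-instance] Quotient.instMeasurableSpace QuotientGroup.measurableSpace

section Volume

variable (K : Type) [Field K] [NumberField K] (γ : GL (Fin 2) K)

attribute [local instance] AdelicGroupData.measurableSpaceQuotientForm
  AdelicGroupData.borelSpaceQuotientForm

/-- `E = C_{M₂(K)}(γ)`. -/
local notation "Eγ" => Subalgebra.centralizer K ({(γ : Matrix (Fin 2) (Fin 2) K)} :
  Set (Matrix (Fin 2) (Fin 2) K))

/-- The adelic group datum of `GL₂`. -/
local notation "G2" => AdelicGroupData.gl 2 K

/-- **The volume factor of an elliptic class of the `GL(2)` trace formula is the covolume of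
`ℝ_{>0} K(γ)ˣ` in the idele group `K(γ)_𝔸ˣ`** (Gelbart (1975), (10.15) and p. 155:
`meas(Z_𝔸 B_F \ B_𝔸)`, `B` the centraliser of the quadratic extension `E = K(γ)`). Let `γ ∈ GL₂(K)`
be non-scalar, `E = C(γ) = K[γ]`, `G_γ = C_{GL₂(𝔸_K)}(γ)`, `H_γ = ℝ_{>0} GL₂(K) ∩ G_γ`, and
`e = glTwoDatumTorusEquiv : E_𝔸ˣ ≃ₜ* G_γ` (carrying `ℝ_{>0} Eˣ` onto `H_γ`). If the Haar-type
measures correspond under `e` — `ν_γ = e_* ν_E` on `G_γ` and `ρ_F = (e|)_* ρ_E` on `H_γ` — then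

  `vol(G_γ ⧸ H_γ; ν_γ, ρ_F) = vol(E_𝔸ˣ ⧸ ℝ_{>0} Eˣ; ν_E, ρ_E)`,

both volumes being total masses of quotient measures with Weil constant one
(`quotientMeasure_univ_eq_of_mulEquiv`, `InvariantQuotientTransport`). The right-hand side is
intrinsic to the quadratic algebra `E` and its measures — the same quantity as on the `D^×` side
(`units_quotientMeasure_centralizer_univ_eq_torus`) once `K(γ) ≅ K(γ')`. The instance binders hold
by `units_adelic_topology`, `isClosed_quotientSubgroup_units` (for `E`),
`isClosed_quotientSubgroup_gl_holds`, `locallyCompactSpace_gl_adelic_holds`, `t2Space_gl` and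
`isClosed_centralizer_singleton`. [cite: Gelbart1975, (10.15) and p. 155] -/
theorem glTwo_quotientMeasure_centralizer_univ_eq_torus
    (hγ : (γ : Matrix (Fin 2) (Fin 2) K) ∉ (⊥ : Subalgebra K (Matrix (Fin 2) (Fin 2) K)))
    [MeasurableSpace (G2).Adelic] [BorelSpace (G2).Adelic]
    [MeasurableSpace (AdelicGroupData.units K Eγ).Adelic] [BorelSpace (AdelicGroupData.units K Eγ).Adelic]
    [LocallyCompactSpace (G2).Adelic] [SecondCountableTopology (G2).Adelic] [T2Space (G2).Adelic]
    [LocallyCompactSpace (AdelicGroupData.units K Eγ).Adelic]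
    [SecondCountableTopology (AdelicGroupData.units K Eγ).Adelic] [T2Space (AdelicGroupData.units K Eγ).Adelic]
    [hH : IsClosed ((G2).quotientSubgroup : Set (G2).Adelic)]
    [hHT : IsClosed (((AdelicGroupData.units K Eγ).quotientSubgroup) : Set (AdelicGroupData.units K Eγ).Adelic)]
    [hCcl : IsClosed ((Subgroup.centralizer ({(G2).toAdelic γ} : Set (G2).Adelic) :
      Subgroup (G2).Adelic) : Set (G2).Adelic)]
    [MeasurableSpace (↥(Subgroup.centralizer ({(G2).toAdelic γ} : Set (G2).Adelic)) ⧸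
      ((G2).quotientSubgroup ⊓ Subgroup.centralizer ({(G2).toAdelic γ} : Set (G2).Adelic)).subgroupOf
        (Subgroup.centralizer ({(G2).toAdelic γ} : Set (G2).Adelic)))]
    [BorelSpace (↥(Subgroup.centralizer ({(G2).toAdelic γ} : Set (G2).Adelic)) ⧸
      ((G2).quotientSubgroup ⊓ Subgroup.centralizer ({(G2).toAdelic γ} : Set (G2).Adelic)).subgroupOf
        (Subgroup.centralizer ({(G2).toAdelic γ} : Set (G2).Adelic)))]
    (νC : Measure (Subgroup.centralizer ({(G2).toAdelic γ} : Set (G2).Adelic)))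
    [IsHaarMeasure νC] [νC.IsMulRightInvariant]
    (ρF : Measure ↥(((G2).quotientSubgroup ⊓ Subgroup.centralizer ({(G2).toAdelic γ} :
      Set (G2).Adelic)).subgroupOf (Subgroup.centralizer ({(G2).toAdelic γ} : Set (G2).Adelic))))
    [ρF.IsMulLeftInvariant] [IsFiniteMeasureOnCompacts ρF] [ρF.IsOpenPosMeasure] [ρF.IsInvInvariant]
    [SFinite ρF]
    (νT : Measure (AdelicGroupData.units K Eγ).Adelic) [IsHaarMeasure νT] [νT.IsMulRightInvariant]
    (ρT : Measure ↥((AdelicGroupData.units K Eγ).quotientSubgroup))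
    [ρT.IsMulLeftInvariant] [IsFiniteMeasureOnCompacts ρT] [ρT.IsOpenPosMeasure] [ρT.IsInvInvariant]
    [SFinite ρT]
    (hν : νC = Measure.map (glTwoDatumTorusEquiv K γ hγ) νT)
    (hρ : ρF = Measure.map (subgroupCongrHomeomorph (glTwoDatumTorusEquiv K γ hγ).toMulEquiv
      ((AdelicGroupData.units K Eγ).quotientSubgroup)
      (((G2).quotientSubgroup ⊓ Subgroup.centralizer ({(G2).toAdelic γ} :
        Set (G2).Adelic)).subgroupOf (Subgroup.centralizer ({(G2).toAdelic γ} : Set (G2).Adelic)))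
      (glTwoDatumTorusEquiv_mem_iff K γ hγ) (glTwoDatumTorusEquiv K γ hγ).continuous
      (glTwoDatumTorusEquiv K γ hγ).symm.continuous) ρT) :
    quotientMeasure (((G2).quotientSubgroup ⊓ Subgroup.centralizer ({(G2).toAdelic γ} :
        Set (G2).Adelic)).subgroupOf (Subgroup.centralizer ({(G2).toAdelic γ} : Set (G2).Adelic)))
        ρF (isClosed_subgroupOf _ _ (hH.inter hCcl)) νC Set.univ =
      quotientMeasure ((AdelicGroupData.units K Eγ).quotientSubgroup) ρT hHT νT Set.univ := by
  haveI : IsClosed (((((G2).quotientSubgroup ⊓ Subgroup.centralizer ({(G2).toAdelic γ} :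
      Set (G2).Adelic)).subgroupOf (Subgroup.centralizer ({(G2).toAdelic γ} : Set (G2).Adelic))) :
        Subgroup (Subgroup.centralizer ({(G2).toAdelic γ} : Set (G2).Adelic))) :
          Set (Subgroup.centralizer ({(G2).toAdelic γ} : Set (G2).Adelic))) :=
    isClosed_subgroupOf _ _ (hH.inter hCcl)
  exact quotientMeasure_univ_eq_of_mulEquiv (glTwoDatumTorusEquiv K γ hγ).toMulEquiv
    (glTwoDatumTorusEquiv K γ hγ).continuous (glTwoDatumTorusEquiv K γ hγ).symm.continuous _ _
    (glTwoDatumTorusEquiv_mem_iff K γ hγ) ρT ρF νT νC hρ hν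

/-- **The torus measures exist** (non-vacuity of `glTwo_quotientMeasure_centralizer_univ_eq_torus`):
given Haar-type measures `ν_γ` on `G_γ` and `ρ_F` on `H_γ`, their pull-backs `ν_E = e⁻¹_* ν_γ`,
`ρ_E = (e|)⁻¹_* ρ_F` along `e = glTwoDatumTorusEquiv` are Haar-type measures on `E_𝔸ˣ`, `ℝ_{>0} Eˣ`
with `ν_γ = e_* ν_E`, `ρ_F = (e|)_* ρ_E`. [folklore] -/
theorem glTwo_exists_torus_measures
    (hγ : (γ : Matrix (Fin 2) (Fin 2) K) ∉ (⊥ : Subalgebra K (Matrix (Fin 2) (Fin 2) K)))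
    [MeasurableSpace (G2).Adelic] [BorelSpace (G2).Adelic]
    [MeasurableSpace (AdelicGroupData.units K Eγ).Adelic] [BorelSpace (AdelicGroupData.units K Eγ).Adelic]
    (νC : Measure (Subgroup.centralizer ({(G2).toAdelic γ} : Set (G2).Adelic)))
    [IsHaarMeasure νC] [νC.IsMulRightInvariant]
    (ρF : Measure ↥(((G2).quotientSubgroup ⊓ Subgroup.centralizer ({(G2).toAdelic γ} :
      Set (G2).Adelic)).subgroupOf (Subgroup.centralizer ({(G2).toAdelic γ} : Set (G2).Adelic))))
    [IsHaarMeasure ρF] [ρF.IsInvInvariant] [SFinite ρF] :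
    ∃ (νT : Measure (AdelicGroupData.units K Eγ).Adelic)
      (ρT : Measure ↥((AdelicGroupData.units K Eγ).quotientSubgroup)),
      IsHaarMeasure νT ∧ νT.IsMulRightInvariant ∧ IsHaarMeasure ρT ∧ ρT.IsInvInvariant ∧
      SFinite ρT ∧ νC = Measure.map (glTwoDatumTorusEquiv K γ hγ) νT ∧
      ρF = Measure.map (subgroupCongrHomeomorph (glTwoDatumTorusEquiv K γ hγ).toMulEquiv
        ((AdelicGroupData.units K Eγ).quotientSubgroup)
        (((G2).quotientSubgroup ⊓ Subgroup.centralizer ({(G2).toAdelic γ} :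
          Set (G2).Adelic)).subgroupOf (Subgroup.centralizer ({(G2).toAdelic γ} : Set (G2).Adelic)))
        (glTwoDatumTorusEquiv_mem_iff K γ hγ) (glTwoDatumTorusEquiv K γ hγ).continuous
        (glTwoDatumTorusEquiv K γ hγ).symm.continuous) ρT := by
  set e := glTwoDatumTorusEquiv K γ hγ with he
  set eH := subgroupCongrHomeomorph e.toMulEquiv
    ((AdelicGroupData.units K Eγ).quotientSubgroup)
    (((G2).quotientSubgroup ⊓ Subgroup.centralizer ({(G2).toAdelic γ} :
      Set (G2).Adelic)).subgroupOf (Subgroup.centralizer ({(G2).toAdelic γ} : Set (G2).Adelic)))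
    (glTwoDatumTorusEquiv_mem_iff K γ hγ) e.continuous e.symm.continuous with heH
  -- the multiplicative structure of `eH`
  set eHm : ↥((AdelicGroupData.units K Eγ).quotientSubgroup) ≃*
      ↥(((G2).quotientSubgroup ⊓ Subgroup.centralizer ({(G2).toAdelic γ} :
        Set (G2).Adelic)).subgroupOf (Subgroup.centralizer ({(G2).toAdelic γ} : Set (G2).Adelic))) :=
    { eH.toEquiv with
      map_mul' := fun x y => Subtype.ext (map_mul e.toMulEquiv (x : (AdelicGroupData.units K Eγ).Adelic) y) }
    with heHm
  refine ⟨Measure.map e.symm νC, Measure.map eHm.symm ρF, inferInstance,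
    isMulRightInvariant_map_mulEquiv e.symm.toMulEquiv e.symm.continuous.measurable
      e.continuous.measurable νC,
    MulEquiv.isHaarMeasure_map ρF eHm.symm eH.symm.continuous eH.continuous,
    isInvInvariant_map_mulEquiv eHm.symm eH.symm.continuous.measurable ρF, inferInstance, ?_, ?_⟩
  · exact (e.toHomeomorph.toMeasurableEquiv.map_map_symm (ν := νC)).symm
  · exact (eH.toMeasurableEquiv.map_map_symm (ν := ρF)).symm

/-- **The hypotheses of `glTwo_quotientMeasure_centralizer_univ_eq_torus` hold**: the closedness
and topological instance binders on `GL₂(𝔸_K)` and `E_𝔸ˣ` are theorems of the tree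
(`isClosed_quotientSubgroup_gl_holds`, `locallyCompactSpace_gl_adelic_holds`, `t2Space_gl`,
second countability of `GL₂(𝔸_K)` through `units_adelic_topology` for `M₂(K)` and the model
isomorphism `unitsMatrixEquivGl`; `units_adelic_topology` for `E`; `isClosed_centralizer_singleton`).
[folklore] -/
theorem glTwo_torus_volume_hypotheses :
    IsClosed ((G2).quotientSubgroup : Set (G2).Adelic) ∧
      LocallyCompactSpace (G2).Adelic ∧ T2Space (G2).Adelic ∧ SecondCountableTopology (G2).Adelic ∧
      IsClosed ((Subgroup.centralizer ({(G2).toAdelic γ} : Set (G2).Adelic) : Subgroup (G2).Adelic) :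
        Set (G2).Adelic) ∧
      LocallyCompactSpace (AdelicGroupData.units K Eγ).Adelic ∧
      T2Space (AdelicGroupData.units K Eγ).Adelic ∧
      SecondCountableTopology (AdelicGroupData.units K Eγ).Adelic ∧
      IsClosed (((AdelicGroupData.units K Eγ).quotientSubgroup) : Set (AdelicGroupData.units K Eγ).Adelic) := by
  haveI : LocallyCompactSpace (G2).Adelic := AdelicGroupData.locallyCompactSpace_gl_adelic_holds 2 K
  haveI : T2Space (G2).Adelic := t2Space_gl 2 K
  -- second countability of `GL₂(𝔸_K)` through the model isomorphism with `(𝔸 ⊗ M₂(K))ˣ`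
  haveI : SecondCountableTopology (G2).Adelic := by
    obtain ⟨-, -, h3⟩ := units_adelic_topology K (Matrix (Fin 2) (Fin 2) K)
    haveI := h3
    exact (AdelicGroupData.unitsMatrixEquivGl K 2).symm.toHomeomorph.secondCountableTopology
  obtain ⟨j₁, j₂, j₃⟩ := units_adelic_topology K Eγ
  haveI : LocallyCompactSpace (AdeleRing (𝓞 K) K) := locallyCompactSpace_adeleRing' K
  haveI : Nontrivial Eγ := ⟨⟨0, 1, fun h => zero_ne_one (congrArg Subtype.val h)⟩⟩
  exact ⟨isClosed_quotientSubgroup_gl_holds 2 K, inferInstance, inferInstance, inferInstance,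
    isClosed_centralizer_singleton _, j₁, j₂, j₃, AdelicGroupData.isClosed_quotientSubgroup_units K Eγ⟩

end Volume

end Literature.NumberTheory.Automorphic
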